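import Mathlib.Tactic.Ring
import Mathlib.Tactic.LinearCombination

/-!
# Flex-tangent norm identities for the `φ̂`-covering cubics of a rational `3`-isogeny
# (bridge data of the second `φ`-descent instrument `phisel3`, kernel-checked)
# (cell `b2b-bsdres`, CLASS-CLOSURE instrument builder 4 = seat cc-eng-4, GEN 101)

HONEST FRAMING (cell `b2b-bsdres`, run/shared/lean/b2b/bsd-rank1-residual/, verbatim in every
file): the goal of the cell is to DELETE the COMBINATION-SHAPED residual classes of the
Birch–Swinnerton-Dyer formula for ALL analytic-rank `≤ 1` elliptic curves over `ℚ` — "full BSD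
formula for every rank `≤ 1` curve in class `C`" assembled STRICTLY from published theorems — so
that the rank-`≤ 1` remainder becomes exactly the CONSTRUCTION-SHAPED classes, which are TYPED
(missing-input `Prop`s), NOT attempted. This is not "finishing BSD". THIS FILE is a class-free TOOL
file (pure commutative algebra, every statement closed by `ring` / `linear_combination` / `grind`);
NOT a Literature fact, NOT a class theorem; it asserts nothing about any curve, closes no item,
books nothing, moves no RESIDUAL-MAP mark.

## What is checked here, and why the instrument needs it

The cell's second implementation of the `#Ш[3^∞]` step at a rational `3`-isogeny `φ : W₀ → Ê`
(`class-closure/eng-4/b24i2/`, design `DESIGN-B24-IMPL2-v0.md`, engine `code/phisel3.gp`) decides,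
for a first-descent class `u`, whether the `φ`-Selmer SET of the `φ̂`-covering `C_u → W₀` is empty,
by the published second-`φ`-descent algorithm of Creutz–Miller (J. Algebra 372 (2012), Thm. 6.2)
run on the published covering cubics of Cohen–Pazuki (Acta Arith. 140 (2009), Thm. 3.1 for
`D = 1`, Thm. 4.1 for `D ≠ 1`). Between the two printed inputs sits ONE piece of data that is the
seat's own derivation (design §(2)(d), 'bridge data'): in the integral coordinates the engine uses,
* the fibre of the covering over `0_{W₀}` is the section `Z = 0`, i.e. the three points
  `x(θ) = (θ : 1 : 0)` with `f(θ) = 0` for an explicit cubic `f` (so Creutz–Miller's `𝔩₂ = h` is the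
  coordinate `Z`, and the cubic étale algebra is `F_u = ℚ[θ]/(f)`);
* the recorded linear form `𝔩₁(θ)` is the tangent form of the cubic at `x(θ)` and vanishes there;
* THE NORM IDENTITY `N_{F_u/ℚ}(𝔩₁) = λ·G + c·Z³` with the recorded constants `λ, c` — these are the
  constants `c, β` of Creutz–Miller (4.6) for OUR cubics, and `c` enters the algorithm's norm
  condition `N(δ) ∈ c·ℚ^{×3}`; a wrong `c` would make every EMPTY verdict unsound.
The design verified these as exact integer-polynomial identities with stdlib scripts
(`b24i2/design-checks/check_d1.py`, `check_cp41.py`, `check_dgen.py`), and the engine re-evaluates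
them numerically-exactly on every row (self-check `S-MODEL`). This file checks them ONCE, in the
kernel, as identities in an arbitrary commutative ring `R`:

* `D = 1` (case Z3; Cohen–Pazuki Thm. 3.1 with `u = m`, `X = z₁`, `Y = −m z₂`, `Z = w`):
  `G = m z₁³ − m² z₂³ + 2 a m z₁ z₂ w + 2 b w³`, `f(θ) = θ³ − m`, `𝔩₁(θ) = 3θ² z₁ − 3m z₂ + 2aθ w`;
  `cubicZ3_fibre`, `flexFormZ3_at_fibre`, `flexFormZ3_tangent`, and the norm identity
  `flexFormZ3_norm`: for ANY `θ₁ θ₂ θ₃` with the Vieta relations of `T³ − m`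
  (`Σθᵢ = 0`, `Σθᵢθⱼ = 0`, `θ₁θ₂θ₃ = m`) — e.g. the three roots in a splitting algebra, which is how
  the field norm of `F_u = ℚ(∛m)` is computed — `𝔩₁(θ₁)𝔩₁(θ₂)𝔩₁(θ₃) = 27m·G + 2m(4a³ − 27b)·w³`;
  corollary `flexFormZ3_norm_of_cube_root` for `θ, ζθ, ζ²θ` with `θ³ = m`, `ζ² + ζ + 1 = 0`.
* `D ≠ 1` (cases MU3 / GEN; Cohen–Pazuki Thm. 4.1 divided by `2`, representative `u = v²·v̄`,
  `v = v₁ + v₂√D`, `N(v) = v₁² − D v₂²`, free symbol `b'` for `b / N(v)`):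
  `G' = v₂X³ + 3v₁X²Y + 3Dv₂XY² + Dv₁Y³ + a(X² − DY²)Z + b'Z³`,
  `f(θ) = v₂θ³ + 3v₁θ² + 3Dv₂θ + Dv₁`,
  `𝔩₁(θ) = (3v₂θ² + 6v₁θ + 3Dv₂)X + (3v₁θ² + 6Dv₂θ + 3Dv₁)Y + a(θ² − D)Z`;
  `cubicGen_fibre`, `flexFormGen_at_fibre`, `flexFormGen_tangent`, and `flexFormGen_norm`: for
  any `θ₁ θ₂ θ₃` with the Vieta relations of the NON-monic `f` (`v₂Σθᵢ = −3v₁`, `v₂Σθᵢθⱼ = 3Dv₂`,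
  `v₂θ₁θ₂θ₃ = −Dv₁`),
  `v₂² · 𝔩₁(θ₁)𝔩₁(θ₂)𝔩₁(θ₃) = 4·D·N(v)·(27·N(v)·G' + (4a³D − 27 b' N(v))·Z³)`,
  i.e. `c ≡ 4·D·N(v)·v₂·(4a³D − 27b) (mod ℚ^{×3})` with `b = b'N(v)`, as the design records.
* The representative step for `D ≠ 1`: with `u·ū = μ³` and `v := 1 + u²/μ³` (the engine's constructive
  Hilbert-90 choice), `u ≡ v²·v̄` modulo cubes — `rep_conj_mul`, `rep_sq_mul_conj`.
* The covering maps land on `W₀ : y² = x³ + D(ax + b)²` and `α ∘ π ≡ u` up to cubes — the printed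
  content of Cohen–Pazuki Thms. 3.1 / 4.1, re-checked in the engine's integral coordinates because
  the per-row self-check evaluates exactly these polynomials: `coveringZ3_on_curve`,
  `coveringZ3_alpha`, `cubicGen_eq_im`, `normForm_cube`, `coveringGen_on_curve`, `coveringGen_alpha`.

Every proof is `ring`, `linear_combination`, or — for the two norm identities, which hold only
modulo the Vieta relations — `grind` (its commutative-ring solver; the same identities were first
reproduced on the hub by exact integer polynomial arithmetic, seat folder `work/bridge/`).
Nothing here uses a property of `ℚ`: `R` is any commutative ring.
-/

namespace Summit.BirchSwinnertonDyer.Rank1Residual.SecondDescent.PhiCovering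

variable {R : Type*} [CommRing R]

/-! ## Case `D = 1` (Z3): the cubic `u X³ + u⁻¹ Y³ + 2b Z³ − 2a XYZ` in integral coordinates -/

/-- The `D = 1` covering cubic in the engine's integral coordinates (`u = m`, `X = z₁`, `Y = −m z₂`,
`Z = w` in Cohen–Pazuki Thm. 3.1): `G = m z₁³ − m² z₂³ + 2 a m z₁ z₂ w + 2 b w³`. -/
def cubicZ3 {R : Type*} [CommRing R] (m a b z₁ z₂ w : R) : R :=
  m * z₁ ^ 3 - m ^ 2 * z₂ ^ 3 + 2 * a * m * z₁ * z₂ * w + 2 * b * w ^ 3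

/-- The recorded flex-tangent linear form at the fibre point `x(θ) = (θ : 1 : 0)`, `θ³ = m`:
`𝔩₁(θ) = 3θ² z₁ − 3m z₂ + 2aθ w` (a linear form in `z₁, z₂, w` with coefficients in `ℚ(θ)`). -/
def flexFormZ3 {R : Type*} [CommRing R] (m a z₁ z₂ w θ : R) : R :=
  3 * θ ^ 2 * z₁ - 3 * m * z₂ + 2 * a * θ * w

/-- The fibre over `0_{W₀}` is `w = 0`: on that line the cubic is `m·(θ³ − m)` at `(θ : 1 : 0)`,
so its three points are `x(θ)` for the three cube roots `θ` of `m` (`F_u = ℚ(∛m)`). -/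
theorem cubicZ3_fibre (m a b θ : R) : cubicZ3 m a b θ 1 0 = m * (θ ^ 3 - m) := by
  unfold cubicZ3; ring

/-- `𝔩₁(θ)` evaluated at a fibre point `x(θ') = (θ' : 1 : 0)` equals `3θ²(θ' − θ) + 3(θ³ − m)`:
it vanishes at `x(θ)` itself when `θ³ = m`, and at no other fibre point over a domain with
`m ≠ 0` (the tangent at a flex meets the flex line `w = 0` only at the flex). -/
theorem flexFormZ3_at_fibre (m a θ θ' : R) :
    flexFormZ3 m a θ' 1 0 θ = 3 * θ ^ 2 * (θ' - θ) + 3 * (θ ^ 3 - m) := by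
  unfold flexFormZ3; ring

/-- `𝔩₁(θ)` vanishes at `x(θ)` when `θ³ = m`. -/
theorem flexFormZ3_at_flex (m a θ : R) (hθ : θ ^ 3 = m) : flexFormZ3 m a θ 1 0 θ = 0 := by
  rw [flexFormZ3_at_fibre]; linear_combination (3 : R) * hθ

/-- `𝔩₁(θ)` IS the tangent form of the cubic at `x(θ)`, up to the unit `m`: `m·𝔩₁(θ)` is the polar
form `z₁·∂G/∂z₁ + z₂·∂G/∂z₂ + w·∂G/∂w` with the formal partial derivatives of `G` evaluated at
`(θ, 1, 0)` — namely `3mθ²`, `−3m²`, `2amθ` (read off from `G`; checked here against `G`'s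
expansion along the line through `x(θ)`: the coefficient of `t` in `G(x(θ) + t·(z₁,z₂,w))`). -/
theorem flexFormZ3_tangent (m a b z₁ z₂ w θ t : R) (hθ : θ ^ 3 = m) :
    cubicZ3 m a b (θ + t * z₁) (1 + t * z₂) (t * w) =
      t * (m * flexFormZ3 m a z₁ z₂ w θ)
        + t ^ 2 * (3 * m * θ * z₁ ^ 2 - 3 * m ^ 2 * z₂ ^ 2 + 2 * a * m * (θ * z₂ + z₁) * w)
        + t ^ 3 * cubicZ3 m a b z₁ z₂ w := by
  unfold cubicZ3 flexFormZ3; linear_combination m * hθ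

/-- THE NORM IDENTITY for `D = 1` (Creutz–Miller (4.6) for this cubic: `N_{F/ℚ}(𝔩₁) = c·h³` on the
curve with `h = w`, `c = 2m(4a³ − 27b)`): for any `θ₁ θ₂ θ₃` satisfying the Vieta relations of
`T³ − m`, `𝔩₁(θ₁)·𝔩₁(θ₂)·𝔩₁(θ₃) = 27m·G + 2m(4a³ − 27b)·w³`. In a splitting algebra of `T³ − m`
over `ℚ(z₁,z₂,w)` the left side is the field norm `N_{F_u/ℚ}(𝔩₁)`, `F_u = ℚ(∛m)`. -/
theorem flexFormZ3_norm (m a b z₁ z₂ w θ₁ θ₂ θ₃ : R) (h₁ : θ₁ + θ₂ + θ₃ = 0)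
    (h₂ : θ₁ * θ₂ + θ₁ * θ₃ + θ₂ * θ₃ = 0) (h₃ : θ₁ * θ₂ * θ₃ = m) :
    flexFormZ3 m a z₁ z₂ w θ₁ * flexFormZ3 m a z₁ z₂ w θ₂ * flexFormZ3 m a z₁ z₂ w θ₃ =
      27 * m * cubicZ3 m a b z₁ z₂ w + 2 * m * (4 * a ^ 3 - 27 * b) * w ^ 3 := by
  -- the product is symmetric in `θ₁ θ₂ θ₃`; its expansion in the elementary symmetric functions
  -- (13 terms, exponents ≤ 2) is the `ring` step, the Vieta substitution the `rw` step
  have key : flexFormZ3 m a z₁ z₂ w θ₁ * flexFormZ3 m a z₁ z₂ w θ₂ * flexFormZ3 m a z₁ z₂ w θ₃ =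
      -27 * m ^ 3 * z₂ ^ 3 + 18 * m ^ 2 * a * z₂ ^ 2 * w * (θ₁ + θ₂ + θ₃)
        + 27 * m ^ 2 * z₁ * z₂ ^ 2 * (θ₁ + θ₂ + θ₃) ^ 2
        - 54 * m ^ 2 * z₁ * z₂ ^ 2 * (θ₁ * θ₂ + θ₁ * θ₃ + θ₂ * θ₃)
        - 12 * m * a ^ 2 * z₂ * w ^ 2 * (θ₁ * θ₂ + θ₁ * θ₃ + θ₂ * θ₃)
        - 18 * m * a * z₁ * z₂ * w * (θ₁ + θ₂ + θ₃) * (θ₁ * θ₂ + θ₁ * θ₃ + θ₂ * θ₃)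
        + 54 * m * a * z₁ * z₂ * w * (θ₁ * θ₂ * θ₃)
        + 54 * m * z₁ ^ 2 * z₂ * (θ₁ + θ₂ + θ₃) * (θ₁ * θ₂ * θ₃)
        - 27 * m * z₁ ^ 2 * z₂ * (θ₁ * θ₂ + θ₁ * θ₃ + θ₂ * θ₃) ^ 2
        + 8 * a ^ 3 * w ^ 3 * (θ₁ * θ₂ * θ₃)
        + 12 * a ^ 2 * z₁ * w ^ 2 * (θ₁ + θ₂ + θ₃) * (θ₁ * θ₂ * θ₃)
        + 18 * a * z₁ ^ 2 * w * (θ₁ * θ₂ + θ₁ * θ₃ + θ₂ * θ₃) * (θ₁ * θ₂ * θ₃)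
        + 27 * z₁ ^ 3 * (θ₁ * θ₂ * θ₃) ^ 2 := by
    unfold flexFormZ3; ring
  rw [h₁, h₂, h₃] at key
  rw [key]; unfold cubicZ3; ring

/-- The same norm identity for the three roots `θ, ζθ, ζ²θ` of `T³ − m` given a cube root `θ` of `m`
and a primitive cube root of unity `ζ` (`ζ² + ζ + 1 = 0`) — the form in which `N_{ℚ(θ)/ℚ}` is the
product over the three embeddings. -/
theorem flexFormZ3_norm_of_cube_root (m a b z₁ z₂ w θ ζ : R) (hθ : θ ^ 3 = m)
    (hζ : ζ ^ 2 + ζ + 1 = 0) :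
    flexFormZ3 m a z₁ z₂ w θ * flexFormZ3 m a z₁ z₂ w (ζ * θ) * flexFormZ3 m a z₁ z₂ w (ζ ^ 2 * θ) =
      27 * m * cubicZ3 m a b z₁ z₂ w + 2 * m * (4 * a ^ 3 - 27 * b) * w ^ 3 := by
  apply flexFormZ3_norm
  · linear_combination θ * hζ
  · linear_combination (θ ^ 2 * ζ) * hζ
  · linear_combination (ζ - 1) * θ ^ 3 * hζ + hθ

/-- The covering map `π(z₁ : z₂ : w) = (x, y)`, `x = m z₁ z₂ / w²`, `y = (m z₁³ + m² z₂³)/(2w³)`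
lands on `W₀ : y² = x³ + (ax + b)²` (Cohen–Pazuki Thm. 3.1, `D = 1`): clearing the denominator
`4w⁶`, `(2w³y)² − 4(w²x)³ − (2a(w²x)w + 2bw³)²` is a multiple of `G`. -/
theorem coveringZ3_on_curve (m a b z₁ z₂ w : R) :
    (m * z₁ ^ 3 + m ^ 2 * z₂ ^ 3) ^ 2 - 4 * (m * z₁ * z₂) ^ 3
        - (2 * a * (m * z₁ * z₂) * w + 2 * b * w ^ 3) ^ 2 =
      -cubicZ3 m a b z₁ z₂ w * (4 * a * m * z₁ * z₂ * w + 4 * b * w ^ 3 - cubicZ3 m a b z₁ z₂ w) := by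
  unfold cubicZ3; ring

/-- `α ∘ π ≡ u` up to cubes (Cohen–Pazuki Thm. 3.1): the first-descent map `α(x, y) = y − (ax + b)`
at `π(z₁ : z₂ : w)` is `(2w³y − 2a(w²x)w − 2bw³)/(2w³)`, and the numerator equals `2m z₁³ − G`,
i.e. `α(π(P)) = m·(z₁/w)³` on the curve `G = 0`. -/
theorem coveringZ3_alpha (m a b z₁ z₂ w : R) :
    m * z₁ ^ 3 + m ^ 2 * z₂ ^ 3 - 2 * a * (m * z₁ * z₂) * w - 2 * b * w ^ 3 =
      2 * m * z₁ ^ 3 - cubicZ3 m a b z₁ z₂ w := by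
  unfold cubicZ3; ring

/-! ## Case `D ≠ 1` (MU3 / GEN): Cohen–Pazuki Thm. 4.1 divided by `2`, representative `u = v² v̄` -/

/-- The `D ≠ 1` covering cubic (Cohen–Pazuki Thm. 4.1 divided by `2`; `v = v₁ + v₂√D`, `b'` stands
for `b / N(v)`): `G' = v₂X³ + 3v₁X²Y + 3Dv₂XY² + Dv₁Y³ + a(X² − DY²)Z + b'Z³`. -/
def cubicGen {R : Type*} [CommRing R] (D a b' v₁ v₂ X Y Z : R) : R :=
  v₂ * X ^ 3 + 3 * v₁ * X ^ 2 * Y + 3 * D * v₂ * X * Y ^ 2 + D * v₁ * Y ^ 3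
    + a * (X ^ 2 - D * Y ^ 2) * Z + b' * Z ^ 3

/-- The fibre cubic `f(θ) = v₂θ³ + 3v₁θ² + 3Dv₂θ + Dv₁` (`F_u = ℚ[θ]/(f)`; NOT monic: `v₂ ≠ 0`
because `u ∉ ℚ^× K^{×3}`). -/
def fibreGen {R : Type*} [CommRing R] (D v₁ v₂ θ : R) : R :=
  v₂ * θ ^ 3 + 3 * v₁ * θ ^ 2 + 3 * D * v₂ * θ + D * v₁

/-- The recorded flex-tangent linear form at `x(θ) = (θ : 1 : 0)`, `f(θ) = 0`:
`𝔩₁(θ) = (3v₂θ² + 6v₁θ + 3Dv₂)X + (3v₁θ² + 6Dv₂θ + 3Dv₁)Y + a(θ² − D)Z`. -/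
def flexFormGen {R : Type*} [CommRing R] (D a v₁ v₂ X Y Z θ : R) : R :=
  (3 * v₂ * θ ^ 2 + 6 * v₁ * θ + 3 * D * v₂) * X + (3 * v₁ * θ ^ 2 + 6 * D * v₂ * θ + 3 * D * v₁) * Y
    + a * (θ ^ 2 - D) * Z

/-- The norm form of `K = ℚ(√D)` on the binary cubic: writing `v·(X + Y√D)³ = Re + Im·√D`,
the cubic part of `G'` IS `Im` (`cubicGen_eq_im`) and `Re² − D·Im² = N(v)·(X² − DY²)³`
(`normForm_cube`). Here `Re`, `Im` are written out. -/
def reCube {R : Type*} [CommRing R] (D v₁ v₂ X Y : R) : R :=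
  v₁ * (X ^ 3 + 3 * D * X * Y ^ 2) + D * v₂ * (3 * X ^ 2 * Y + D * Y ^ 3)

/-- The `√D`-component of `v·(X + Y√D)³` (see `reCube`). -/
def imCube {R : Type*} [CommRing R] (D v₁ v₂ X Y : R) : R :=
  v₂ * (X ^ 3 + 3 * D * X * Y ^ 2) + v₁ * (3 * X ^ 2 * Y + D * Y ^ 3)

/-- In any ring with an element `s`, `s² = D`: `(v₁ + v₂ s)(X + Y s)³ = Re + Im·s`. -/
theorem reCube_add_imCube (D v₁ v₂ X Y s : R) (hs : s ^ 2 = D) :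
    (v₁ + v₂ * s) * (X + Y * s) ^ 3 = reCube D v₁ v₂ X Y + imCube D v₁ v₂ X Y * s := by
  unfold reCube imCube
  linear_combination (D * v₂ * Y ^ 3 + 3 * v₁ * X * Y ^ 2 + v₁ * Y ^ 3 * s + 3 * v₂ * X ^ 2 * Y
    + 3 * v₂ * X * Y ^ 2 * s + v₂ * Y ^ 3 * s ^ 2) * hs

/-- The cubic part of `G'` is `Im(v·(X + Y√D)³)`: `G' = Im + a(X² − DY²)Z + b'Z³`. -/
theorem cubicGen_eq_im (D a b' v₁ v₂ X Y Z : R) :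
    cubicGen D a b' v₁ v₂ X Y Z = imCube D v₁ v₂ X Y + a * (X ^ 2 - D * Y ^ 2) * Z + b' * Z ^ 3 := by
  unfold cubicGen imCube; ring

/-- Multiplicativity of the norm form: `Re² − D·Im² = N(v)·(X² − DY²)³`, `N(v) = v₁² − Dv₂²`. -/
theorem normForm_cube (D v₁ v₂ X Y : R) :
    reCube D v₁ v₂ X Y ^ 2 - D * imCube D v₁ v₂ X Y ^ 2 =
      (v₁ ^ 2 - D * v₂ ^ 2) * (X ^ 2 - D * Y ^ 2) ^ 3 := by
  unfold reCube imCube; ring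

/-- The fibre over `0_{W₀}` is `Z = 0`: there `G'(θ, 1, 0) = f(θ)`. -/
theorem cubicGen_fibre (D a b' v₁ v₂ θ : R) : cubicGen D a b' v₁ v₂ θ 1 0 = fibreGen D v₁ v₂ θ := by
  unfold cubicGen fibreGen; ring

/-- `𝔩₁(θ)` at a fibre point `x(θ') = (θ' : 1 : 0)` equals `(θ' − θ)·f′(θ) + 3·f(θ)` with
`f′(θ) = 3v₂θ² + 6v₁θ + 3Dv₂` the formal derivative: it vanishes at `x(θ)` when `f(θ) = 0`, and at
no other fibre point when `f` is separable over a domain. -/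
theorem flexFormGen_at_fibre (D a v₁ v₂ θ θ' : R) :
    flexFormGen D a v₁ v₂ θ' 1 0 θ =
      (θ' - θ) * (3 * v₂ * θ ^ 2 + 6 * v₁ * θ + 3 * D * v₂) + 3 * fibreGen D v₁ v₂ θ := by
  unfold flexFormGen fibreGen; ring

/-- `𝔩₁(θ)` vanishes at `x(θ)` when `f(θ) = 0`. -/
theorem flexFormGen_at_flex (D a v₁ v₂ θ : R) (hθ : fibreGen D v₁ v₂ θ = 0) :
    flexFormGen D a v₁ v₂ θ 1 0 θ = 0 := by
  rw [flexFormGen_at_fibre, hθ]; ring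

/-- `𝔩₁(θ)` IS the tangent (polar) form of `G'` at `x(θ)`: the coefficient of `t` in
`G'(x(θ) + t·(X, Y, Z))` is `𝔩₁(θ)` (the constant coefficient is `f(θ)`, the top one `G'`). -/
theorem flexFormGen_tangent (D a b' v₁ v₂ X Y Z θ t : R) :
    cubicGen D a b' v₁ v₂ (θ + t * X) (1 + t * Y) (t * Z) =
      fibreGen D v₁ v₂ θ + t * flexFormGen D a v₁ v₂ X Y Z θ
        + t ^ 2 * (3 * v₂ * θ * X ^ 2 + 3 * v₁ * X ^ 2 + 6 * v₁ * θ * X * Y + 6 * D * v₂ * X * Y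
          + 3 * D * v₂ * θ * Y ^ 2 + 3 * D * v₁ * Y ^ 2 + 2 * a * θ * X * Z - 2 * a * D * Y * Z)
        + t ^ 3 * cubicGen D a b' v₁ v₂ X Y Z := by
  unfold cubicGen fibreGen flexFormGen; ring

/-- THE NORM IDENTITY for `D ≠ 1` (Creutz–Miller (4.6) for this cubic): for any `θ₁ θ₂ θ₃`
satisfying the Vieta relations of the non-monic fibre cubic `f` — e.g. its three roots in a
splitting algebra, which is how `N_{F_u/ℚ}` is computed —
`v₂²·𝔩₁(θ₁)𝔩₁(θ₂)𝔩₁(θ₃) = 4·D·N(v)·(27·N(v)·G' + (4a³D − 27·b'·N(v))·Z³)`, `N(v) = v₁² − Dv₂²`.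
With `b = b'·N(v)` this is `c = 4DN(v)(4a³D − 27b)/v₂² ≡ 4·D·N(v)·v₂·(4a³D − 27b) (mod ℚ^{×3})`,
the constant the engine records. (Proof: `grind`'s commutative-ring solver; the expansion of the
symmetric product in `v₂Σθᵢ, v₂Σθᵢθⱼ, v₂θ₁θ₂θ₃` has 114 terms — reproduced exactly on the hub.) -/
theorem flexFormGen_norm (D a b' v₁ v₂ X Y Z θ₁ θ₂ θ₃ : R) (h₁ : v₂ * (θ₁ + θ₂ + θ₃) = -(3 * v₁))
    (h₂ : v₂ * (θ₁ * θ₂ + θ₁ * θ₃ + θ₂ * θ₃) = 3 * D * v₂) (h₃ : v₂ * (θ₁ * θ₂ * θ₃) = -(D * v₁)) :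
    v₂ ^ 2 * (flexFormGen D a v₁ v₂ X Y Z θ₁ * flexFormGen D a v₁ v₂ X Y Z θ₂
        * flexFormGen D a v₁ v₂ X Y Z θ₃) =
      4 * D * (v₁ ^ 2 - D * v₂ ^ 2) * (27 * (v₁ ^ 2 - D * v₂ ^ 2) * cubicGen D a b' v₁ v₂ X Y Z
        + (4 * a ^ 3 * D - 27 * b' * (v₁ ^ 2 - D * v₂ ^ 2)) * Z ^ 3) := by
  unfold flexFormGen cubicGen
  grind

/-- The covering map `π(X : Y : Z) = (x, y)`, `x = N(v)(X² − DY²)/Z²`, `y = N(v)·Re/Z³` lands on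
`W₀ : y² = x³ + D(ax + b)²` with `b = b'N(v)` (Cohen–Pazuki Thm. 4.1): clearing `Z⁶`,
`(N(v)Re)² − (N(v)(X² − DY²))³ − D(a·N(v)(X² − DY²)·Z + b'N(v)·Z³)²` is a multiple of `G'`. -/
theorem coveringGen_on_curve (D a b' v₁ v₂ X Y Z : R) :
    ((v₁ ^ 2 - D * v₂ ^ 2) * reCube D v₁ v₂ X Y) ^ 2 - ((v₁ ^ 2 - D * v₂ ^ 2) * (X ^ 2 - D * Y ^ 2)) ^ 3
        - D * (a * ((v₁ ^ 2 - D * v₂ ^ 2) * (X ^ 2 - D * Y ^ 2)) * Z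
          + b' * (v₁ ^ 2 - D * v₂ ^ 2) * Z ^ 3) ^ 2 =
      D * (v₁ ^ 2 - D * v₂ ^ 2) ^ 2 * cubicGen D a b' v₁ v₂ X Y Z
        * (cubicGen D a b' v₁ v₂ X Y Z - 2 * a * (X ^ 2 - D * Y ^ 2) * Z - 2 * b' * Z ^ 3) := by
  unfold reCube cubicGen; ring

/-- `α ∘ π ≡ u` up to cubes (Cohen–Pazuki Thm. 4.1): `α(x, y) = y − (ax + b)√D` at `π(P)` is
`N(v)·(Re − √D·(a(X² − DY²)Z + b'Z³))/Z³`; on the curve `G' = 0` the bracket is `Re + √D·Im`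
`= v·(X + Y√D)³` (`reCube_add_imCube`), so `α(π(P)) = N(v)·v·((X + Y√D)/Z)³ = v²v̄·(cube)`.
The polynomial content: `a(X² − DY²)Z + b'Z³ = G' − Im`. -/
theorem coveringGen_alpha (D a b' v₁ v₂ X Y Z : R) :
    a * (X ^ 2 - D * Y ^ 2) * Z + b' * Z ^ 3 = cubicGen D a b' v₁ v₂ X Y Z - imCube D v₁ v₂ X Y := by
  unfold cubicGen imCube; ring

/-! ## The representative `u = v²·v̄` for `D ≠ 1` (the engine's constructive Hilbert-90 step) -/

/-- Cohen–Pazuki (p. 7) need a representative of the class `[u] ∈ K^×/K^{×3}` of the shape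
`v²·v̄`; the engine takes `v := 1 + u²/μ³` when `N(u) = u·ū = μ³` (and `v ≠ 0`). The polynomial
content, with `V := μ³ + u² = μ³·v` and `V̄ := μ³ + ū² = μ³·v̄`: `u²·V̄ = μ³·V`. -/
theorem rep_conj_mul (u ū μ : R) (h : u * ū = μ ^ 3) :
    u ^ 2 * (μ ^ 3 + ū ^ 2) = μ ^ 3 * (μ ^ 3 + u ^ 2) := by
  linear_combination (u * ū + μ ^ 3) * h

/-- Hence `v²·v̄·(uμ²)³ = u·v³μ⁹`, i.e. `(μ³v)²·(μ³v̄)·u³ = μ³·u·(μ³v)³`: `u ≡ v²v̄` modulo cubes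
(divide by the cube `(uμ²)³`; in the engine `u`, `μ`, `V` are non-zero field elements). -/
theorem rep_sq_mul_conj (u ū μ : R) (h : u * ū = μ ^ 3) :
    (μ ^ 3 + u ^ 2) ^ 2 * (μ ^ 3 + ū ^ 2) * u ^ 3 = μ ^ 3 * u * (μ ^ 3 + u ^ 2) ^ 3 := by
  linear_combination (u * (μ ^ 3 + u ^ 2) ^ 2 * (u * ū + μ ^ 3)) * h

end Summit.BirchSwinnertonDyer.Rank1Residual.SecondDescent.PhiCovering
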